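import Summits.ValiantsHypothesis.ValiantsHypothesis.Theorems.LacunarySymmetroidMatrixDescartesPivotRankOneCriticalWindowsRootCount

/-!
# `MatrixDescartes` census — rank-one `(2,K)₁`: PIVOT-DIRECTION SEPARATION
# (at a scale `x*` whose optimal direction is the pivot letter's position, the gap profile separates:
# `Φ(x) < Φ(x*)` for `x < x*` and `Φ(x) > Φ(x*)` for `x > x*` — so the positive roots of `det F` never straddle `x*`)

HONEST FRAMING.  Object-search cell `pub-symmetroid`, seat `val-sym-mdr-p1` (generation 25); helper file `--supports` the crux item
stmt-ValiantsHypothesis-18050 (`Theses.LacunarySymmetroid.MatrixDescartes`, OPEN, on HOLD) with NO closure claim.  A STRUCTURE theorem for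
the `1|K−1` rank-one hyperbolic row (`F(x) = x^e[[0,1],[1,0]] + ∑ₖ wₖx^{dₖ}(1,tₖ)(1,tₖ)ᵀ`, ONE letter `p` with `dₚ < e`, the others with
`dₖ > e`, positive weights and positions, not all letters parallel), valid for EVERY `K` and every exponent configuration.  Nothing here
bears on `MatrixDescartes` in its window, on `DoorA26` / `DoorA34`, registers / credences, or `VP ≠ VNP`; the rank-one register is unchanged.

THE OBJECTS (as in `…CriticalWindowsRootCount`).  `A = ∑ Wₖ`, `U = ∑ Wₖtₖ`, `C = ∑ Wₖtₖ²`, `Wₖ = wₖx^{dₖ}`; the gap profile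
`Φ(x) = (√(AC) − U)/x^e` (`det F(x) = 0 ⟺ Φ(x) = 1`); the optimal direction `T̂(x)`, `A T̂² = C`.  A PIVOT-DIRECTION SCALE is an `x* > 0`
with `T̂(x*) = tₚ`, i.e. `∑ₖ Wₖ(x*)(tₖ² − tₚ²) = 0` (the optimal direction of the window profile at `x*` is the pivot letter's own position).

THE THEOREM (§3, §4).  **`gap_lt_of_lt_pivotScale`**: `x < x* ⇒ Φ(x) < Φ(x*)`; **`gap_lt_of_pivotScale_lt`**: `x* < x ⇒ Φ(x*) < Φ(x)`
(both in the cross-multiplied form `(√(AC) − U)(x)·x*^e < (√(AC) − U)(x*)·x^e`, resp. `>`).  PROOF.  (A) `2(√(AC) − U) = min_T ∑ₖWₖ(T − tₖ)²/T`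
(AM–GM, §1 `two_mul_sqrt_sub_le`), and at `T = tₚ` the pivot letter's term VANISHES: `2x^eΦ(x) ≤ n(x) := ∑_{k≠p} Wₖ(tₚ − tₖ)²/tₚ`, the
NEEDLE BOUND; `n(x)/x^e` is strictly increasing (`dₖ > e` off the pivot letter), and equality holds at `x*` (§2 `gap_eq_needle_of_pivotScale`,
`√(AC) = A tₚ` there).  (B) THE KEY IDENTITY (§2 `pivotScale_identity`): at a pivot-direction scale,
`∑_{k≠p} Wₖ*(T − tₖ)² − (T/tₚ)·∑_{k≠p} Wₖ*(tₚ − tₖ)² = (∑_{k≠p} Wₖ*)·(T − tₚ)²` for EVERY `T` (three coefficients of a quadratic in `T`; the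
constant one is `C* = tₚ²A*`).  Hence for `x > x*` and every `T > 0`: `x*^e·∑ₖWₖ(x)(T − tₖ)² ≥ x^e·∑_{k≠p}Wₖ*(T − tₖ)²` termwise
(`x^{dₖ}x*^e > x*^{dₖ}x^e` for `dₖ > e`; the pivot term is dropped) `= x^e·[(T/tₚ)n* tₚ… ] ≥ x^e·T·n*/tₚ`, strictly (§4 `pivotScale_core`);
at `T = T̂(x)` the left side is `2T̂·x*^e·(√(AC) − U)(x)` and `n*/… = 2x*^e… Φ(x*)`, which is (B).
CONSEQUENCE (§5 **`not_straddle_pivotScale`**, **`eq_of_root_pivotScale`**): two positive roots of `det F` never lie on opposite sides of a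
pivot-direction scale, and a pivot-direction scale that is a root is the ONLY positive root.  So for every pencil ALL positive roots of
`det F` lie in ONE cell of `(0,∞) ∖ {T̂ = tₚ}`, on which the optimal direction stays on ONE side of the pivot letter — the root count
LOCALISES to one side (companion `…CriticalWindowsSideCount`: `Z₊ ≤ 1 + max(C_L, C_R)`, and the MIDDLE-PIVOT LAW `Z₊ ≤ 3` at `K = 3`).
LOCATED FIRST (seat memo ROOT-COUNT.md, hub python, exact to 1e-6): 3 944/3 944 both-sided `K = 3` middle-pivot samples have the slow
letter's dent entirely below and before the fast letter's dent; the separation (A),(B) 5 600/5 600 for arbitrary weights.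

[folklore] AM–GM, `Real.sqrt` algebra, natural-power monotonicity, `Finset` sums.  No definitions, no named facts.
-/

-- `Summit.ValiantsHypothesis.ValiantsHypothesis.…` repeats a component by the D-0017 layout
-- (single-conjunct summit), which the `dupNamespace` linter flags; the name is mandated.
set_option linter.dupNamespace false

namespace Summit.ValiantsHypothesis.ValiantsHypothesis.Theorems.LacunarySymmetroidMatrixDescartes.Pivot.CriticalWindows.Separation

open Finset
open scoped BigOperators
open Summit.ValiantsHypothesis.ValiantsHypothesis.Theorems.LacunarySymmetroidMatrixDescartes.Pivot.CriticalWindows.RootCount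
  (moments_pos)

/-! ## 1. The needle bound: AM–GM at an arbitrary direction -/

/-- **AM–GM in profile form.**  For `A, C ≥ 0` and any real `T`: `2T·√(AC) ≤ A T² + C` (`(T√A − √C)² ≥ 0`). [folklore] -/
theorem two_mul_sqrt_le (A C T : ℝ) (hA : 0 ≤ A) (hC : 0 ≤ C) :
    2 * T * Real.sqrt (A * C) ≤ A * T ^ 2 + C := by
  have hsq : Real.sqrt (A * C) = Real.sqrt A * Real.sqrt C := Real.sqrt_mul hA C
  rw [hsq]
  nlinarith [sq_nonneg (T * Real.sqrt A - Real.sqrt C), Real.sq_sqrt hA, Real.sq_sqrt hC, Real.sqrt_nonneg A, Real.sqrt_nonneg C]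

/-- **THE NEEDLE BOUND.**  For positive data, `x > 0` and ANY real direction `T`:
`2T·(√(A(x)C(x)) − U(x)) ≤ ∑ₖ wₖx^{dₖ}(T − tₖ)²` — twice the gap is at most the window profile's numerator at every direction. [folklore] -/
theorem two_mul_gap_le_sum {ι : Type*} (s : Finset ι) (hs : s.Nonempty) (w t : ι → ℝ) (d : ι → ℕ)
    (hw : ∀ m ∈ s, 0 < w m) (ht : ∀ m ∈ s, 0 < t m) {x : ℝ} (hx : 0 < x) (T : ℝ) :
    2 * T * (Real.sqrt ((∑ k ∈ s, w k * x ^ d k) * (∑ k ∈ s, w k * t k ^ 2 * x ^ d k)) - ∑ k ∈ s, w k * t k * x ^ d k)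
      ≤ ∑ k ∈ s, w k * x ^ d k * (T - t k) ^ 2 := by
  obtain ⟨hA, -, hC⟩ := moments_pos s hs w t d hw ht hx
  have h := two_mul_sqrt_le _ _ T hA.le hC.le
  have hnum : ∑ k ∈ s, w k * x ^ d k * (T - t k) ^ 2
      = (∑ k ∈ s, w k * x ^ d k) * T ^ 2 - 2 * (∑ k ∈ s, w k * t k * x ^ d k) * T + ∑ k ∈ s, w k * t k ^ 2 * x ^ d k := by
    rw [Finset.sum_mul, Finset.mul_sum, Finset.sum_mul, ← Finset.sum_sub_distrib, ← Finset.sum_add_distrib]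
    exact Finset.sum_congr rfl fun k _ => by ring
  rw [hnum]
  nlinarith [h]

/-! ## 2. At a pivot-direction scale: the gap equals the needle, and the key identity -/

/-- **GAP = NEEDLE AT A PIVOT-DIRECTION SCALE.**  If `∑ₖ Wₖ(tₖ² − tₚ²) = 0` at `x*` (i.e. `C = tₚ²A`, `T̂(x*) = tₚ`), then
`2tₚ·(√(AC) − U) = ∑ₖ Wₖ(tₚ − tₖ)²` there (`√(AC) = A tₚ`). [folklore] -/
theorem gap_eq_needle_of_pivotScale {ι : Type*} (s : Finset ι) (hs : s.Nonempty) (w t : ι → ℝ) (d : ι → ℕ) (p : ι)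
    (hw : ∀ m ∈ s, 0 < w m) (ht : ∀ m ∈ s, 0 < t m) (htp : 0 < t p) {y : ℝ} (hy : 0 < y)
    (hstar : ∑ k ∈ s, w k * y ^ d k * (t k ^ 2 - t p ^ 2) = 0) :
    2 * t p * (Real.sqrt ((∑ k ∈ s, w k * y ^ d k) * (∑ k ∈ s, w k * t k ^ 2 * y ^ d k)) - ∑ k ∈ s, w k * t k * y ^ d k)
      = ∑ k ∈ s, w k * y ^ d k * (t p - t k) ^ 2 := by
  obtain ⟨hA, -, hC⟩ := moments_pos s hs w t d hw ht hy
  have hCA : ∑ k ∈ s, w k * t k ^ 2 * y ^ d k = (∑ k ∈ s, w k * y ^ d k) * t p ^ 2 := by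
    have : ∑ k ∈ s, w k * y ^ d k * (t k ^ 2 - t p ^ 2)
        = (∑ k ∈ s, w k * t k ^ 2 * y ^ d k) - (∑ k ∈ s, w k * y ^ d k) * t p ^ 2 := by
      rw [Finset.sum_mul, ← Finset.sum_sub_distrib]
      exact Finset.sum_congr rfl fun k _ => by ring
    linarith [this.symm.trans hstar]
  have hsqrt : Real.sqrt ((∑ k ∈ s, w k * y ^ d k) * (∑ k ∈ s, w k * t k ^ 2 * y ^ d k)) = (∑ k ∈ s, w k * y ^ d k) * t p := by
    rw [hCA]
    have : (∑ k ∈ s, w k * y ^ d k) * ((∑ k ∈ s, w k * y ^ d k) * t p ^ 2) = ((∑ k ∈ s, w k * y ^ d k) * t p) ^ 2 := by ring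
    rw [this, Real.sqrt_sq (mul_pos hA htp).le]
  have hnum : ∑ k ∈ s, w k * y ^ d k * (t p - t k) ^ 2
      = (∑ k ∈ s, w k * y ^ d k) * t p ^ 2 - 2 * (∑ k ∈ s, w k * t k * y ^ d k) * t p + ∑ k ∈ s, w k * t k ^ 2 * y ^ d k := by
    rw [Finset.sum_mul, Finset.mul_sum, Finset.sum_mul, ← Finset.sum_sub_distrib, ← Finset.sum_add_distrib]
    exact Finset.sum_congr rfl fun k _ => by ring
  rw [hsqrt, hnum, hCA]
  ring

/-- **THE KEY IDENTITY AT A PIVOT-DIRECTION SCALE.**  If `∑ₖ Wₖ*(tₖ² − tₚ²) = 0`, then for EVERY real `T`: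
`∑ₖ Wₖ*(T − tₖ)² − (T/tₚ)·∑ₖ Wₖ*(tₚ − tₖ)² = (∑ₖ Wₖ*)·(T − tₚ)²` (both sides are quadratics in `T` with the same leading coefficient, the
same value `0`-coefficient — this is the hypothesis — and the same value at `T = tₚ`; stated cleared of the denominator `tₚ`). [folklore] -/
theorem pivotScale_identity {ι : Type*} (s : Finset ι) (W t : ι → ℝ) (tp T : ℝ)
    (hstar : ∑ k ∈ s, W k * (t k ^ 2 - tp ^ 2) = 0) :
    tp * ∑ k ∈ s, W k * (T - t k) ^ 2 - T * ∑ k ∈ s, W k * (tp - t k) ^ 2 = tp * (∑ k ∈ s, W k) * (T - tp) ^ 2 := by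
  have h1 : tp * ∑ k ∈ s, W k * (T - t k) ^ 2 - T * ∑ k ∈ s, W k * (tp - t k) ^ 2 - tp * (∑ k ∈ s, W k) * (T - tp) ^ 2
      = (tp - T) * ∑ k ∈ s, W k * (t k ^ 2 - tp ^ 2) := by
    rw [Finset.mul_sum, Finset.mul_sum, Finset.mul_sum, Finset.sum_mul, Finset.mul_sum, ← Finset.sum_sub_distrib,
      ← Finset.sum_sub_distrib]
    exact Finset.sum_congr rfl fun k _ => by ring
  rw [hstar, mul_zero] at h1
  linarith

/-! ## 3. Below a pivot-direction scale the gap is smaller -/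

/-- Strict comparison of the non-pivot monomials across two scales: for `e < dₖ` and `0 < x < y`: `x^{dₖ}·y^e < y^{dₖ}·x^e`. [folklore] -/
theorem pow_mul_pow_lt {x y : ℝ} (hx : 0 < x) (hxy : x < y) {e n : ℕ} (hen : e < n) :
    x ^ n * y ^ e < y ^ n * x ^ e := by
  obtain ⟨m, rfl⟩ := Nat.exists_eq_add_of_lt hen
  have hy : 0 < y := hx.trans hxy
  have h1 : x ^ (m + 1) < y ^ (m + 1) := pow_lt_pow_left₀ hxy hx.le (Nat.succ_ne_zero m)
  have : x ^ (e + m + 1) * y ^ e = (x * y) ^ e * x ^ (m + 1) := by ring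
  have : y ^ (e + m + 1) * x ^ e = (x * y) ^ e * y ^ (m + 1) := by ring
  nlinarith [pow_pos (mul_pos hx hy) e]

/-- **(A) BELOW A PIVOT-DIRECTION SCALE THE GAP IS SMALLER.**  Positive data, `dₚ < e` hmm only `e < dₖ` off the pivot letter is used, not all letters
parallel to the pivot letter; `x*` a pivot-direction scale (`∑ₖ Wₖ(x*)(tₖ² − tₚ²) = 0`).  Then for `0 < x < x*`:
`(√(AC) − U)(x)·x*^e < (√(AC) − U)(x*)·x^e`, i.e. `Φ(x) < Φ(x*)`.  Proof: needle bound at `x` (direction `tₚ`, the pivot term vanishes),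
strict termwise growth of the needle `∑_{k≠p} wₖx^{dₖ−e}(tₚ − tₖ)²` in `x`, needle = gap at `x*`. [this file] -/
theorem gap_lt_of_lt_pivotScale {ι : Type*} (s : Finset ι) (w t : ι → ℝ) (d : ι → ℕ) (e : ℕ) (p : ι) (hp : p ∈ s)
    (hw : ∀ m ∈ s, 0 < w m) (ht : ∀ m ∈ s, 0 < t m) (hdm : ∀ m ∈ s, m ≠ p → e < d m) (hnp : ∃ m ∈ s, t m ≠ t p)
    {x y : ℝ} (hx : 0 < x) (hxy : x < y) (hstar : ∑ k ∈ s, w k * y ^ d k * (t k ^ 2 - t p ^ 2) = 0) :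
    (Real.sqrt ((∑ k ∈ s, w k * x ^ d k) * (∑ k ∈ s, w k * t k ^ 2 * x ^ d k)) - ∑ k ∈ s, w k * t k * x ^ d k) * y ^ e
      < (Real.sqrt ((∑ k ∈ s, w k * y ^ d k) * (∑ k ∈ s, w k * t k ^ 2 * y ^ d k)) - ∑ k ∈ s, w k * t k * y ^ d k) * x ^ e := by
  have hs : s.Nonempty := ⟨p, hp⟩
  have hy : 0 < y := hx.trans hxy
  have htp : 0 < t p := ht p hp
  -- needle bound at x, direction t_p
  have hN := two_mul_gap_le_sum s hs w t d hw ht hx (t p)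
  -- gap = needle at y
  have hE := gap_eq_needle_of_pivotScale s hs w t d p hw ht htp hy hstar
  -- termwise growth of the needle (times the cross powers)
  have hle : ∀ k ∈ s, w k * x ^ d k * (t p - t k) ^ 2 * y ^ e ≤ w k * y ^ d k * (t p - t k) ^ 2 * x ^ e := by
    intro k hk
    by_cases hkp : k = p
    · subst hkp; simp
    · have h := (pow_mul_pow_lt hx hxy (hdm k hk hkp)).le
      have : w k * x ^ d k * (t p - t k) ^ 2 * y ^ e = (w k * (t p - t k) ^ 2) * (x ^ d k * y ^ e) := by ring
      have : w k * y ^ d k * (t p - t k) ^ 2 * x ^ e = (w k * (t p - t k) ^ 2) * (y ^ d k * x ^ e) := by ring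
      nlinarith [mul_nonneg (hw k hk).le (sq_nonneg (t p - t k))]
  obtain ⟨m, hm, hmt⟩ := hnp
  have hmp : m ≠ p := fun h => hmt (by rw [h])
  have hlt : w m * x ^ d m * (t p - t m) ^ 2 * y ^ e < w m * y ^ d m * (t p - t m) ^ 2 * x ^ e := by
    have h := pow_mul_pow_lt hx hxy (hdm m hm hmp)
    have hc : 0 < w m * (t p - t m) ^ 2 := mul_pos (hw m hm) (by positivity)
    have : w m * x ^ d m * (t p - t m) ^ 2 * y ^ e = (w m * (t p - t m) ^ 2) * (x ^ d m * y ^ e) := by ring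
    have : w m * y ^ d m * (t p - t m) ^ 2 * x ^ e = (w m * (t p - t m) ^ 2) * (y ^ d m * x ^ e) := by ring
    nlinarith
  have hsum : ∑ k ∈ s, w k * x ^ d k * (t p - t k) ^ 2 * y ^ e < ∑ k ∈ s, w k * y ^ d k * (t p - t k) ^ 2 * x ^ e :=
    Finset.sum_lt_sum hle ⟨m, hm, hlt⟩
  rw [← Finset.sum_mul, ← Finset.sum_mul] at hsum
  -- assemble: 2 t_p · gap(x) · y^e ≤ needle(x) · y^e < needle(y) · x^e = 2 t_p · gap(y) · x^e
  have hye : 0 < y ^ e := pow_pos hy e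
  have h1 := mul_le_mul_of_nonneg_right hN hye.le
  have h2 : (∑ k ∈ s, w k * y ^ d k * (t p - t k) ^ 2) * x ^ e
      = 2 * t p * ((Real.sqrt ((∑ k ∈ s, w k * y ^ d k) * (∑ k ∈ s, w k * t k ^ 2 * y ^ d k))
          - ∑ k ∈ s, w k * t k * y ^ d k) * x ^ e) := by
    rw [← hE]; ring
  have h3 : 2 * t p * ((Real.sqrt ((∑ k ∈ s, w k * x ^ d k) * (∑ k ∈ s, w k * t k ^ 2 * x ^ d k))
      - ∑ k ∈ s, w k * t k * x ^ d k) * y ^ e)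
      < 2 * t p * ((Real.sqrt ((∑ k ∈ s, w k * y ^ d k) * (∑ k ∈ s, w k * t k ^ 2 * y ^ d k))
          - ∑ k ∈ s, w k * t k * y ^ d k) * x ^ e) := by
    have : 2 * t p * ((Real.sqrt ((∑ k ∈ s, w k * x ^ d k) * (∑ k ∈ s, w k * t k ^ 2 * x ^ d k))
        - ∑ k ∈ s, w k * t k * x ^ d k) * y ^ e)
        = 2 * t p * (Real.sqrt ((∑ k ∈ s, w k * x ^ d k) * (∑ k ∈ s, w k * t k ^ 2 * x ^ d k))
          - ∑ k ∈ s, w k * t k * x ^ d k) * y ^ e := by ring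
    rw [this, ← h2]
    exact lt_of_le_of_lt h1 hsum
  exact lt_of_mul_lt_mul_left h3 (by positivity)

/-! ## 4. Above a pivot-direction scale the gap is larger -/

/-- **CORE INEQUALITY ABOVE A PIVOT-DIRECTION SCALE.**  With `x*` a pivot-direction scale and `x* < x`, for EVERY real direction `T`:
`tₚ·x*^e·∑ₖ Wₖ(x)(T − tₖ)² > x^e·T·∑ₖ Wₖ(x*)(tₚ − tₖ)²`.  Proof: drop the pivot term on the left, compare the other monomials termwise
(`x^{dₖ}x*^e ≥ x*^{dₖ}x^e`), and use the key identity (its right side `(∑_{k≠p}Wₖ*)(T − tₚ)²` is non-negative); strictness from the pivot term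
(`T ≠ tₚ`) or from a non-parallel letter (`T = tₚ`). [this file] -/
theorem pivotScale_core {ι : Type*} (s : Finset ι) (w t : ι → ℝ) (d : ι → ℕ) (e : ℕ) (p : ι) (hp : p ∈ s)
    (hw : ∀ m ∈ s, 0 < w m) (ht : ∀ m ∈ s, 0 < t m) (hdm : ∀ m ∈ s, m ≠ p → e < d m) (hnp : ∃ m ∈ s, t m ≠ t p)
    {x y : ℝ} (T : ℝ) (hy : 0 < y) (hyx : y < x) (hstar : ∑ k ∈ s, w k * y ^ d k * (t k ^ 2 - t p ^ 2) = 0) :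
    x ^ e * T * ∑ k ∈ s, w k * y ^ d k * (t p - t k) ^ 2 < t p * y ^ e * ∑ k ∈ s, w k * x ^ d k * (T - t k) ^ 2 := by
  classical
  have hx : 0 < x := hy.trans hyx
  have htp : 0 < t p := ht p hp
  -- the key identity on the non-pivot letters (the pivot term of `hstar` vanishes)
  have hstar' : ∑ k ∈ s.erase p, w k * y ^ d k * (t k ^ 2 - t p ^ 2) = 0 := by
    rw [← Finset.add_sum_erase s _ hp] at hstar
    simpa using hstar
  have hid := pivotScale_identity (s.erase p) (fun k => w k * y ^ d k) t (t p) T hstar'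
  -- split off the pivot terms
  have hL : ∑ k ∈ s, w k * x ^ d k * (T - t k) ^ 2
      = w p * x ^ d p * (T - t p) ^ 2 + ∑ k ∈ s.erase p, w k * x ^ d k * (T - t k) ^ 2 := (Finset.add_sum_erase s _ hp).symm
  have hR : ∑ k ∈ s, w k * y ^ d k * (t p - t k) ^ 2 = ∑ k ∈ s.erase p, w k * y ^ d k * (t p - t k) ^ 2 := by
    rw [← Finset.add_sum_erase s _ hp]; simp
  -- termwise comparison on the non-pivot letters
  have hle : ∀ k ∈ s.erase p, w k * y ^ d k * (T - t k) ^ 2 * x ^ e ≤ w k * x ^ d k * (T - t k) ^ 2 * y ^ e := by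
    intro k hk
    have hkp : k ≠ p := Finset.ne_of_mem_erase hk
    have hks : k ∈ s := Finset.mem_of_mem_erase hk
    have h := (pow_mul_pow_lt hy hyx (hdm k hks hkp)).le
    have : w k * y ^ d k * (T - t k) ^ 2 * x ^ e = (w k * (T - t k) ^ 2) * (y ^ d k * x ^ e) := by ring
    have : w k * x ^ d k * (T - t k) ^ 2 * y ^ e = (w k * (T - t k) ^ 2) * (x ^ d k * y ^ e) := by ring
    nlinarith [mul_nonneg (hw k hks).le (sq_nonneg (T - t k))]
  have hsum : ∑ k ∈ s.erase p, w k * y ^ d k * (T - t k) ^ 2 * x ^ e ≤ ∑ k ∈ s.erase p, w k * x ^ d k * (T - t k) ^ 2 * y ^ e :=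
    Finset.sum_le_sum hle
  rw [← Finset.sum_mul, ← Finset.sum_mul] at hsum
  have hApos : 0 < ∑ k ∈ s.erase p, w k * y ^ d k := by
    obtain ⟨m, hm, hmt⟩ := hnp
    have hmp : m ≠ p := fun h => hmt (by rw [h])
    exact Finset.sum_pos' (fun k hk => (mul_pos (hw k (Finset.mem_of_mem_erase hk)) (pow_pos hy _)).le)
      ⟨m, Finset.mem_erase.2 ⟨hmp, hm⟩, mul_pos (hw m hm) (pow_pos hy _)⟩
  have hxe : 0 < x ^ e := pow_pos hx e
  have hye : 0 < y ^ e := pow_pos hy e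
  have hpivot : 0 ≤ w p * x ^ d p * (T - t p) ^ 2 := mul_nonneg (mul_pos (hw p hp) (pow_pos hx _)).le (sq_nonneg _)
  -- strictness: either T ≠ t_p (pivot term and identity term positive) or T = t_p (a non-parallel letter gains strictly)
  rcases eq_or_ne T (t p) with hTp | hTp
  · -- T = t_p: strict termwise gain at a non-parallel letter
    obtain ⟨m, hm, hmt⟩ := hnp
    have hmp : m ≠ p := fun h => hmt (by rw [h])
    have hlt : w m * y ^ d m * (T - t m) ^ 2 * x ^ e < w m * x ^ d m * (T - t m) ^ 2 * y ^ e := by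
      have h := pow_mul_pow_lt hy hyx (hdm m hm hmp)
      have hne : T - t m ≠ 0 := by rw [hTp]; exact sub_ne_zero.2 hmt.symm
      have hc : 0 < w m * (T - t m) ^ 2 := mul_pos (hw m hm) (by positivity)
      have : w m * y ^ d m * (T - t m) ^ 2 * x ^ e = (w m * (T - t m) ^ 2) * (y ^ d m * x ^ e) := by ring
      have : w m * x ^ d m * (T - t m) ^ 2 * y ^ e = (w m * (T - t m) ^ 2) * (x ^ d m * y ^ e) := by ring
      nlinarith
    have hsum' : ∑ k ∈ s.erase p, w k * y ^ d k * (T - t k) ^ 2 * x ^ e < ∑ k ∈ s.erase p, w k * x ^ d k * (T - t k) ^ 2 * y ^ e :=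
      Finset.sum_lt_sum hle ⟨m, Finset.mem_erase.2 ⟨hmp, hm⟩, hlt⟩
    rw [← Finset.sum_mul, ← Finset.sum_mul] at hsum'
    rw [hL, hR]
    have hnn : 0 ≤ (t p * ∑ k ∈ s.erase p, w k * y ^ d k) * (T - t p) ^ 2 := by positivity
    have h1 : T * ∑ k ∈ s.erase p, w k * y ^ d k * (t p - t k) ^ 2 ≤ t p * ∑ k ∈ s.erase p, w k * y ^ d k * (T - t k) ^ 2 := by
      linarith [hid, hnn]
    have h2 := mul_le_mul_of_nonneg_left h1 hxe.le
    have h3 := mul_lt_mul_of_pos_left hsum' htp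
    have h4 : 0 ≤ t p * y ^ e * (w p * x ^ d p * (T - t p) ^ 2) := by positivity
    nlinarith [h2, h3, h4]
  · have hsq : 0 < (T - t p) ^ 2 := by
      have : T - t p ≠ 0 := sub_ne_zero.2 hTp
      positivity
    have hpivot' : 0 < w p * x ^ d p * (T - t p) ^ 2 := mul_pos (mul_pos (hw p hp) (pow_pos hx _)) hsq
    rw [hL, hR]
    have hnn : 0 ≤ (t p * ∑ k ∈ s.erase p, w k * y ^ d k) * (T - t p) ^ 2 := by positivity
    have h1 : T * ∑ k ∈ s.erase p, w k * y ^ d k * (t p - t k) ^ 2 ≤ t p * ∑ k ∈ s.erase p, w k * y ^ d k * (T - t k) ^ 2 := by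
      linarith [hid, hnn]
    have h2 := mul_le_mul_of_nonneg_left h1 hxe.le
    have h3 := mul_le_mul_of_nonneg_left hsum htp.le
    have h4 : 0 < t p * y ^ e * (w p * x ^ d p * (T - t p) ^ 2) := by positivity
    nlinarith [h2, h3, h4]

/-- **(B) ABOVE A PIVOT-DIRECTION SCALE THE GAP IS LARGER.**  For `x* < x`: `(√(AC) − U)(x*)·x^e < (√(AC) − U)(x)·x*^e`, i.e.
`Φ(x*) < Φ(x)`.  Proof: the core inequality at the optimal direction `T̂(x)` (where the window numerator is `2T̂` times the gap) against
`gap = needle` at `x*`. [this file] -/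
theorem gap_lt_of_pivotScale_lt {ι : Type*} (s : Finset ι) (w t : ι → ℝ) (d : ι → ℕ) (e : ℕ) (p : ι) (hp : p ∈ s)
    (hw : ∀ m ∈ s, 0 < w m) (ht : ∀ m ∈ s, 0 < t m) (hdm : ∀ m ∈ s, m ≠ p → e < d m) (hnp : ∃ m ∈ s, t m ≠ t p)
    {x y : ℝ} (hy : 0 < y) (hyx : y < x) (hstar : ∑ k ∈ s, w k * y ^ d k * (t k ^ 2 - t p ^ 2) = 0) :
    (Real.sqrt ((∑ k ∈ s, w k * y ^ d k) * (∑ k ∈ s, w k * t k ^ 2 * y ^ d k)) - ∑ k ∈ s, w k * t k * y ^ d k) * x ^ e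
      < (Real.sqrt ((∑ k ∈ s, w k * x ^ d k) * (∑ k ∈ s, w k * t k ^ 2 * x ^ d k)) - ∑ k ∈ s, w k * t k * x ^ d k) * y ^ e := by
  have hs : s.Nonempty := ⟨p, hp⟩
  have hx : 0 < x := hy.trans hyx
  have htp : 0 < t p := ht p hp
  obtain ⟨hA, hU, hC⟩ := moments_pos s hs w t d hw ht hx
  -- the optimal direction at x
  set τ : ℝ := Real.sqrt ((∑ k ∈ s, w k * t k ^ 2 * x ^ d k) / ∑ k ∈ s, w k * x ^ d k) with hτ
  have hτpos : 0 < τ := Real.sqrt_pos.2 (div_pos hC hA)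
  have hτC : (∑ k ∈ s, w k * x ^ d k) * τ ^ 2 = ∑ k ∈ s, w k * t k ^ 2 * x ^ d k := by
    rw [hτ, Real.sq_sqrt (div_pos hC hA).le]; field_simp
  -- at the optimal direction the window numerator is 2τ·gap
  have hgap : 2 * τ * (Real.sqrt ((∑ k ∈ s, w k * x ^ d k) * (∑ k ∈ s, w k * t k ^ 2 * x ^ d k)) - ∑ k ∈ s, w k * t k * x ^ d k)
      = ∑ k ∈ s, w k * x ^ d k * (τ - t k) ^ 2 := by
    have hsqrt : Real.sqrt ((∑ k ∈ s, w k * x ^ d k) * (∑ k ∈ s, w k * t k ^ 2 * x ^ d k)) = (∑ k ∈ s, w k * x ^ d k) * τ := by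
      rw [← hτC]
      have : (∑ k ∈ s, w k * x ^ d k) * ((∑ k ∈ s, w k * x ^ d k) * τ ^ 2) = ((∑ k ∈ s, w k * x ^ d k) * τ) ^ 2 := by ring
      rw [this, Real.sqrt_sq (mul_pos hA hτpos).le]
    have hnum : ∑ k ∈ s, w k * x ^ d k * (τ - t k) ^ 2
        = (∑ k ∈ s, w k * x ^ d k) * τ ^ 2 - 2 * (∑ k ∈ s, w k * t k * x ^ d k) * τ + ∑ k ∈ s, w k * t k ^ 2 * x ^ d k := by
      rw [Finset.sum_mul, Finset.mul_sum, Finset.sum_mul, ← Finset.sum_sub_distrib, ← Finset.sum_add_distrib]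
      exact Finset.sum_congr rfl fun k _ => by ring
    rw [hsqrt, hnum, ← hτC]; ring
  have hcore := pivotScale_core s w t d e p hp hw ht hdm hnp τ hy hyx hstar
  have hE := gap_eq_needle_of_pivotScale s hs w t d p hw ht htp hy hstar
  -- x^e τ · needle(y) < t_p y^e · 2τ gap(x)  and  needle(y) = 2 t_p gap(y)
  rw [← hgap, ← hE] at hcore
  have h2 : 0 < 2 * τ * t p := by positivity
  nlinarith [hcore]

/-! ## 5. Consequence: the positive roots of `det F` never straddle a pivot-direction scale -/

/-- **ROOTS DO NOT STRADDLE A PIVOT-DIRECTION SCALE.**  If `x₁ ≤ x* ≤ x₂` with `x*` a pivot-direction scale and both `x₁`, `x₂` are zeros of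
the gap equation `√(AC) − U = x^e` (equivalently roots of `det F = AC − (U + x^e)²`), then `x₁ = x₂` (`= x*`).  For `x₁ < x*`:
`1 = Φ(x₁) < Φ(x*)`; for `x* < x₂`: `Φ(x*) < Φ(x₂) = 1` — impossible together, and either one excludes `Φ(x*) = 1`. [this file] -/
theorem not_straddle_pivotScale {ι : Type*} (s : Finset ι) (w t : ι → ℝ) (d : ι → ℕ) (e : ℕ) (p : ι) (hp : p ∈ s)
    (hw : ∀ m ∈ s, 0 < w m) (ht : ∀ m ∈ s, 0 < t m) (hdm : ∀ m ∈ s, m ≠ p → e < d m) (hnp : ∃ m ∈ s, t m ≠ t p)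
    {x₁ y x₂ : ℝ} (hx₁ : 0 < x₁) (h₁ : x₁ ≤ y) (h₂ : y ≤ x₂)
    (hstar : ∑ k ∈ s, w k * y ^ d k * (t k ^ 2 - t p ^ 2) = 0)
    (hr₁ : Real.sqrt ((∑ k ∈ s, w k * x₁ ^ d k) * (∑ k ∈ s, w k * t k ^ 2 * x₁ ^ d k)) - ∑ k ∈ s, w k * t k * x₁ ^ d k = x₁ ^ e)
    (hr₂ : Real.sqrt ((∑ k ∈ s, w k * x₂ ^ d k) * (∑ k ∈ s, w k * t k ^ 2 * x₂ ^ d k)) - ∑ k ∈ s, w k * t k * x₂ ^ d k = x₂ ^ e) :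
    x₁ = x₂ := by
  have hy : 0 < y := lt_of_lt_of_le hx₁ h₁
  have hx₂ : 0 < x₂ := lt_of_lt_of_le hy h₂
  -- Φ(y) compared with 1 from both sides
  set gy := Real.sqrt ((∑ k ∈ s, w k * y ^ d k) * (∑ k ∈ s, w k * t k ^ 2 * y ^ d k)) - ∑ k ∈ s, w k * t k * y ^ d k with hgy
  have hge : y ^ e ≤ gy := by
    rcases h₁.lt_or_eq with hlt | heq
    · have h := gap_lt_of_lt_pivotScale s w t d e p hp hw ht hdm hnp hx₁ hlt hstar
      rw [hr₁] at h
      -- x₁^e y^e < gy x₁^e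
      nlinarith [pow_pos hx₁ e, pow_pos hy e]
    · rw [hgy, ← heq, hr₁]
  have hle : gy ≤ y ^ e := by
    rcases h₂.lt_or_eq with hlt | heq
    · have h := gap_lt_of_pivotScale_lt s w t d e p hp hw ht hdm hnp hy hlt hstar
      rw [hr₂] at h
      nlinarith [pow_pos hx₂ e, pow_pos hy e]
    · rw [hgy, heq, hr₂]
  -- so Φ(y) = 1, and then neither strict inequality can hold: x₁ = y = x₂
  have hgy1 : gy = y ^ e := le_antisymm hle hge
  have e1 : x₁ = y := by
    by_contra hne
    have hlt : x₁ < y := lt_of_le_of_ne h₁ hne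
    have h := gap_lt_of_lt_pivotScale s w t d e p hp hw ht hdm hnp hx₁ hlt hstar
    rw [hr₁, ← hgy, hgy1] at h
    nlinarith [pow_pos hx₁ e, pow_pos hy e]
  have e2 : y = x₂ := by
    by_contra hne
    have hlt : y < x₂ := lt_of_le_of_ne h₂ hne
    have h := gap_lt_of_pivotScale_lt s w t d e p hp hw ht hdm hnp hy hlt hstar
    rw [hr₂, ← hgy, hgy1] at h
    nlinarith [pow_pos hx₂ e, pow_pos hy e]
  rw [e1, e2]

end Summit.ValiantsHypothesis.ValiantsHypothesis.Theorems.LacunarySymmetroidMatrixDescartes.Pivot.CriticalWindows.Separation
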